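import Mathlib
import HarnessLib
import Summits.PneNP.PneNP.Theses.RamseyUncertifiable
import Summits.PneNP.PneNP.Theorems.RamseyUncertifiableRamseyNotNPCliqueCount
import Summits.PneNP.PneNP.Theorems.RamseyUncertifiableRamseyNotNPUnionArith
import Summits.PneNP.PneNP.Theorems.RamseyUncertifiableRamseyNotNPThresholdBelowPoly

/-!
# Line `Sketch` (card `typical-one-sided-capture`) — skeleton for the crux `RamseyNotNP`
(stmt-PneNP-9814, route `RamseyUncertifiable`), lead prover-line-stmt-PneNP-9814-0

X = `RamseyNotNP` : RAMSEY₂ := codes of graphs `⟨n, G⟩` with `ω(G), α(G) < ⌈2 log₂ n⌉ = Nat.clog 2 (n²)`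
is not in `NP`.

Composition (kernel-checked below, `RamseyNotNP_of`):

* `stub_cliqueCount` (A, provable now): for a fixed vertex set `S`, the graphs on `Fin n` in which `S`
  is a `k`-clique number at most `|all graphs| / 2^{C(k,2)}` (product injection `(G, F ⊆ pairs S) ↦ G \ F`).
* `stub_unionArith` (B, provable now): `M · C(n, k(n)) < 2^{C(k(n),2)}` eventually, `k(n) = Nat.clog 2 (n²)`
  (as in the landed `two_mul_choose_lt_two_pow_choose_two`: `(k!·C(n,k))² ≤ 2^{k²} = 2^{2C(k,2)+k}` and
  `(k!)² > M²·2^k` for `k ≥ k₀(M)`).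
* glue (proved here): complement symmetry of the clique count, the union bound
  `#non-Ramsey · 2^{C(k,2)} ≤ 2·C(n,k)·#graphs`, hence **RamseyDense**: for every `c > 0`, eventually more
  than `(1 - c)·#graphs` of the graphs on `Fin n` are 2-Ramsey (quantitative Erdős 1947 at the exact threshold).
* `stub_typicalCliqueCapture` (D = TCC, conjecture-grade, held by the lead): every `NP` language of graph codes
  all of whose members are `k(n)`-clique-free misses a constant fraction of all graphs on `Fin n` for
  infinitely many `n`.
* `RamseyNotNP_of : A → B → D → RamseyNotNP`: RAMSEY₂ ⊆ CLIQUEFREE has density → 1 (RamseyDense), so if it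
  were in `NP` TCC would make it miss a constant fraction infinitely often — contradiction.
* `stub_thresholdBelowPoly` (C, provable now) feeds the alternative entry (see the end of the file)
  `A → B → C → nPCR(ε) → RamseyNotNP` via `typicalCliqueCapture_of_planted` (nPCR = NP-form planted-clique refutation
  hypothesis at clique size `⌈n^{1/2-ε}⌉`, the standard-shape belief one polynomial scale up).

Conventions: `sorry` appears ONLY in `stub_*` theorems — after wave 1 (A p85860, B p85736, C p85754 landed under
`Theorems/`) the ONLY remaining `sorry` is Stub D (TCC). All stub signatures are pure Mathlib /
route vocabulary (no new definitions), stated under `open scoped Classical`.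
-/

set_option linter.dupNamespace false

namespace Summit.PneNP.PneNP.Cruxes.RamseyNotNP.TypicalCapture

open Finset
open Literature.Computability.Complexity
open Summit.PneNP.PneNP.Theses.RamseyUncertifiable (RamseyNotNP)

noncomputable section
open scoped Classical

/-! ### The four registered stubs (`sorry` lives ONLY here) -/

/-- **Stub A — clique count (provable now, M).** For every vertex set `S ⊆ Fin n`, the number of graphs on
`Fin n` in which `S` is a `k`-clique, times `2^{C(k,2)}`, is at most the number of all graphs on `Fin n`
(if `|S| ≠ k` the filter is empty). Proof plan: the map `(G, F) ↦ G.deleteEdges F` on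
`{G | G.IsNClique k S} × 𝒫(pairs of S)` is injective (`F` = the pairs of `S` missing from the image,
`G` = image with all pairs of `S` restored), and `|pairs of S| = C(k,2)` (`Sym2.card_image_offDiag`). -/
theorem stub_cliqueCount :
    ∀ (n k : ℕ) (S : Finset (Fin n)),
      (univ.filter fun G : SimpleGraph (Fin n) => G.IsNClique k S).card * 2 ^ k.choose 2 ≤
        Fintype.card (SimpleGraph (Fin n)) :=
  -- LANDED (wave 1, p85860): Theorems/RamseyUncertifiableRamseyNotNPCliqueCount.lean
  Summit.PneNP.PneNP.Theorems.RamseyNotNP.TypicalCapture.stub_cliqueCount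

/-- **Stub B — union-bound arithmetic at the threshold (provable now, S/M).** For every `M`, eventually
`M · C(n, k) < 2^{C(k,2)}` where `k = Nat.clog 2 (n²)`: from `n² ≤ 2^k` (`Nat.le_pow_clog`),
`k!·C(n,k) ≤ n^k` (`Nat.descFactorial_le_pow`), `2·C(k,2) + k = k²` and `(k!)² > M²·2^k` for `k ≥ k₀(M)`
(e.g. `k! ≥ (k-3)·2^k` for `k ≥ 4`), with `k ≥ k₀` once `2^{k₀} ≤ n²` (`Nat.lt_clog_iff_pow_lt`).
Template: `Summit.PneNP.PneNP.Theorems.two_mul_choose_lt_two_pow_choose_two` (the case `M = 2`, `k ≥ 4`). -/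
theorem stub_unionArith :
    ∀ M : ℕ, ∃ n₀ : ℕ, ∀ n ≥ n₀,
      M * n.choose (Nat.clog 2 (n ^ 2)) < 2 ^ (Nat.clog 2 (n ^ 2)).choose 2 :=
  -- LANDED (wave 1, p85736): Theorems/RamseyUncertifiableRamseyNotNPUnionArith.lean
  Summit.PneNP.PneNP.Theorems.RamseyNotNP.TypicalCapture.stub_unionArith

/-- **Stub C — the Erdős threshold is below every polynomial (provable now, S).** For `0 < ε < 1/2`,
eventually `Nat.clog 2 (n²) ≤ ⌈n^{1/2-ε}⌉₊` (`Nat.clog 2 (n²) ≤ 2·log₂ n + 1` and `log n = o(n^δ)`,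
`Real.isLittleO_log_rpow_atTop`). Used only by the alternative entry `RamseyNotNP_of_planted`. -/
theorem stub_thresholdBelowPoly :
    ∀ ε : ℝ, 0 < ε → ε < 1 / 2 → ∃ N : ℕ, ∀ n ≥ N,
      Nat.clog 2 (n ^ 2) ≤ ⌈(n : ℝ) ^ (1 / 2 - ε)⌉₊ :=
  -- LANDED (wave 1, p85754): Theorems/RamseyUncertifiableRamseyNotNPThresholdBelowPoly.lean
  Summit.PneNP.PneNP.Theorems.RamseyNotNP.TypicalCapture.stub_thresholdBelowPoly

/-- **Stub D — TCC, typical one-sided capture (conjecture-grade; held by the lead).** Every `NP` language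
of graph codes all of whose members are `⌈2log₂ n⌉`-clique-free misses a constant fraction of ALL graphs on
`Fin n` for infinitely many `n`: no NP property certifies `ω(G) < ⌈2 log₂ n⌉` for asymptotically all
graphs (the `k = ⌈2log₂ n⌉` endpoint of nondeterministic planted-clique refutation). Together with
RamseyDense it implies `CLIQUEFREE_{⌈2log₂n⌉} ∉ NP`, hence `coNP ≠ NP` (Disproof §9–§10): crux-sized. -/
theorem stub_typicalCliqueCapture :
    ∀ S : Set (Σ n, SimpleGraph (Fin n)),
      encodingGraph.toLanguage S ∈ Nondeterministic.NP →
      S ⊆ {p | p.2.CliqueFree (Nat.clog 2 (p.1 ^ 2))} →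
      ∃ c : ℝ, 0 < c ∧ ∀ n₀ : ℕ, ∃ n ≥ n₀,
        ((univ.filter fun G : SimpleGraph (Fin n) => (⟨n, G⟩ : Σ m, SimpleGraph (Fin m)) ∈ S).card : ℝ) ≤
          (1 - c) * Fintype.card (SimpleGraph (Fin n)) := by
  sorry

/-! ### Name-keyed statements of the stubs (the hypotheses of the composition) -/
namespace Registered

/-- Statement of Stub A. -/
abbrev stub_cliqueCount : Prop :=
  ∀ (n k : ℕ) (S : Finset (Fin n)),
    (univ.filter fun G : SimpleGraph (Fin n) => G.IsNClique k S).card * 2 ^ k.choose 2 ≤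
      Fintype.card (SimpleGraph (Fin n))

/-- Statement of Stub B. -/
abbrev stub_unionArith : Prop :=
  ∀ M : ℕ, ∃ n₀ : ℕ, ∀ n ≥ n₀, M * n.choose (Nat.clog 2 (n ^ 2)) < 2 ^ (Nat.clog 2 (n ^ 2)).choose 2

/-- Statement of Stub C. -/
abbrev stub_thresholdBelowPoly : Prop :=
  ∀ ε : ℝ, 0 < ε → ε < 1 / 2 → ∃ N : ℕ, ∀ n ≥ N, Nat.clog 2 (n ^ 2) ≤ ⌈(n : ℝ) ^ (1 / 2 - ε)⌉₊

/-- Statement of Stub D (TCC). -/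
abbrev stub_typicalCliqueCapture : Prop :=
  ∀ S : Set (Σ n, SimpleGraph (Fin n)),
    encodingGraph.toLanguage S ∈ Nondeterministic.NP →
    S ⊆ {p | p.2.CliqueFree (Nat.clog 2 (p.1 ^ 2))} →
    ∃ c : ℝ, 0 < c ∧ ∀ n₀ : ℕ, ∃ n ≥ n₀,
      ((univ.filter fun G : SimpleGraph (Fin n) => (⟨n, G⟩ : Σ m, SimpleGraph (Fin m)) ∈ S).card : ℝ) ≤
        (1 - c) * Fintype.card (SimpleGraph (Fin n))

end Registered

/-! ### Glue (proved): complement symmetry, union bound, RamseyDense -/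

/-- Complement symmetry: `S` is an independent `k`-set of `G` iff it is a `k`-clique of `Gᶜ`, and `G ↦ Gᶜ`
is a bijection of the graphs on `Fin n`, so both counts agree. -/
theorem card_filter_compl_isNClique (n k : ℕ) (S : Finset (Fin n)) :
    (univ.filter fun G : SimpleGraph (Fin n) => Gᶜ.IsNClique k S).card =
      (univ.filter fun G : SimpleGraph (Fin n) => G.IsNClique k S).card := by
  refine card_bij' (fun G _ => Gᶜ) (fun G _ => Gᶜ) ?_ ?_ ?_ ?_
  · intro G hG
    simp only [mem_filter, mem_univ, true_and] at hG ⊢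
    exact hG
  · intro G hG
    simp only [mem_filter, mem_univ, true_and] at hG ⊢
    simpa only [compl_compl] using hG
  · intro G _
    simp
  · intro G _
    simp

/-- **Union bound.** The graphs on `Fin n` with a homogeneous `k`-set, times `2^{C(k,2)}`, number at most
`2·C(n,k)·#graphs`: cover by the `C(n,k)` candidate sets `S` and the two ways (`S` clique / `S` independent)
and apply Stub A to each (independent sets via `card_filter_compl_isNClique`). -/
theorem badCount_mul_le (hA : Registered.stub_cliqueCount) (n k : ℕ) :
    (univ.filter fun G : SimpleGraph (Fin n) => ¬ (G.CliqueFree k ∧ Gᶜ.CliqueFree k)).card * 2 ^ k.choose 2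
      ≤ 2 * n.choose k * Fintype.card (SimpleGraph (Fin n)) := by
  have hcover : (univ.filter fun G : SimpleGraph (Fin n) => ¬ (G.CliqueFree k ∧ Gᶜ.CliqueFree k)) ⊆
      (univ.powersetCard k).biUnion fun S =>
        (univ.filter fun G : SimpleGraph (Fin n) => G.IsNClique k S) ∪
          (univ.filter fun G : SimpleGraph (Fin n) => Gᶜ.IsNClique k S) := by
    intro G hG
    rw [mem_filter] at hG
    rw [mem_biUnion]
    by_cases h1 : G.CliqueFree k
    · have h2 : ¬ Gᶜ.CliqueFree k := fun h2 => hG.2 ⟨h1, h2⟩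
      simp only [SimpleGraph.CliqueFree, not_forall, not_not] at h2
      obtain ⟨S, hS⟩ := h2
      refine ⟨S, mem_powersetCard.mpr ⟨subset_univ _, hS.card_eq⟩, mem_union_right _ ?_⟩
      simpa using hS
    · simp only [SimpleGraph.CliqueFree, not_forall, not_not] at h1
      obtain ⟨S, hS⟩ := h1
      refine ⟨S, mem_powersetCard.mpr ⟨subset_univ _, hS.card_eq⟩, mem_union_left _ ?_⟩
      simpa using hS
  calc (univ.filter fun G : SimpleGraph (Fin n) => ¬ (G.CliqueFree k ∧ Gᶜ.CliqueFree k)).card * 2 ^ k.choose 2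
      ≤ (∑ S ∈ univ.powersetCard k,
          ((univ.filter fun G : SimpleGraph (Fin n) => G.IsNClique k S).card +
            (univ.filter fun G : SimpleGraph (Fin n) => Gᶜ.IsNClique k S).card)) * 2 ^ k.choose 2 := by
        gcongr
        exact (card_le_card hcover).trans
          (card_biUnion_le.trans (sum_le_sum fun S _ => card_union_le _ _))
    _ = ∑ S ∈ univ.powersetCard k,
          2 * ((univ.filter fun G : SimpleGraph (Fin n) => G.IsNClique k S).card * 2 ^ k.choose 2) := by
        rw [sum_mul]
        refine sum_congr rfl fun S _ => ?_
        rw [card_filter_compl_isNClique]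
        ring
    _ ≤ ∑ S ∈ univ.powersetCard k, 2 * Fintype.card (SimpleGraph (Fin n)) :=
        sum_le_sum fun S _ => Nat.mul_le_mul_left 2 (hA n k S)
    _ = 2 * n.choose k * Fintype.card (SimpleGraph (Fin n)) := by
        rw [sum_const, card_powersetCard, card_univ, Fintype.card_fin, smul_eq_mul]
        ring

/-- **RamseyDense (quantitative Erdős 1947 at the exact threshold).** From Stubs A and B: for every `c > 0`,
eventually more than `(1 - c)·#graphs` of the graphs on `Fin n` have neither a clique nor an independent set
of size `Nat.clog 2 (n²)`. (Take `M = ⌈2/c⌉₊ + 1` in Stub B; then `#bad · 2^{C(k,2)} · M ≤ 2·#graphs·M·C(n,k)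
< 2·#graphs·2^{C(k,2)}`, so `#bad < 2·#graphs / M < c·#graphs`.) -/
theorem ramseyDense_of (hA : Registered.stub_cliqueCount) (hB : Registered.stub_unionArith)
    (c : ℝ) (hc : 0 < c) :
    ∃ n₀ : ℕ, ∀ n ≥ n₀, (1 - c) * (Fintype.card (SimpleGraph (Fin n)) : ℝ) <
      ((univ.filter fun G : SimpleGraph (Fin n) =>
        (⟨n, G⟩ : Σ m, SimpleGraph (Fin m)) ∈
          {p : Σ m, SimpleGraph (Fin m) | p.2.CliqueFree (Nat.clog 2 (p.1 ^ 2)) ∧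
            p.2ᶜ.CliqueFree (Nat.clog 2 (p.1 ^ 2))}).card : ℝ) := by
  obtain ⟨n₀, hn₀⟩ := hB (⌈2 / c⌉₊ + 1)
  refine ⟨n₀, fun n hn => ?_⟩
  -- abbreviations
  set k : ℕ := Nat.clog 2 (n ^ 2) with hk
  set T : ℕ := Fintype.card (SimpleGraph (Fin n)) with hT
  set M : ℕ := ⌈2 / c⌉₊ + 1 with hM
  have hB' : M * n.choose k < 2 ^ k.choose 2 := hn₀ n hn
  have hA' := badCount_mul_le hA n k
  -- good + bad = all
  have hsplit :
      (univ.filter fun G : SimpleGraph (Fin n) =>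
          (⟨n, G⟩ : Σ m, SimpleGraph (Fin m)) ∈
            {p : Σ m, SimpleGraph (Fin m) | p.2.CliqueFree (Nat.clog 2 (p.1 ^ 2)) ∧
              p.2ᶜ.CliqueFree (Nat.clog 2 (p.1 ^ 2))}).card +
        (univ.filter fun G : SimpleGraph (Fin n) => ¬ (G.CliqueFree k ∧ Gᶜ.CliqueFree k)).card = T := by
    have h1 : (univ.filter fun G : SimpleGraph (Fin n) =>
          (⟨n, G⟩ : Σ m, SimpleGraph (Fin m)) ∈
            {p : Σ m, SimpleGraph (Fin m) | p.2.CliqueFree (Nat.clog 2 (p.1 ^ 2)) ∧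
              p.2ᶜ.CliqueFree (Nat.clog 2 (p.1 ^ 2))}) =
        (univ.filter fun G : SimpleGraph (Fin n) => G.CliqueFree k ∧ Gᶜ.CliqueFree k) := by
      ext G
      simp only [mem_filter, mem_univ, true_and, Set.mem_setOf_eq, hk]
    rw [h1, hT, ← card_univ]
    exact card_filter_add_card_filter_not _
  -- real arithmetic
  have hTpos : (0 : ℝ) < T := by
    have : 0 < T := Fintype.card_pos
    exact_mod_cast this
  have hMc : 2 / c < (M : ℝ) := by
    have h := Nat.le_ceil (2 / c)
    rw [hM]
    push_cast
    linarith
  have hMpos : (0 : ℝ) < M := lt_trans (by positivity) hMc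
  have hcM : 2 < c * M := by
    have : c * (2 / c) = 2 := by field_simp
    nlinarith
  set b : ℕ := (univ.filter fun G : SimpleGraph (Fin n) => ¬ (G.CliqueFree k ∧ Gᶜ.CliqueFree k)).card
    with hb
  have hPpos : (0 : ℝ) < (2 : ℝ) ^ k.choose 2 := by positivity
  have hA'' : (b : ℝ) * (2 : ℝ) ^ k.choose 2 ≤ 2 * (n.choose k : ℝ) * T := by exact_mod_cast hA'
  have hB'' : (M : ℝ) * (n.choose k : ℝ) < (2 : ℝ) ^ k.choose 2 := by exact_mod_cast hB'
  -- `b · 2^C · M ≤ 2 T (M · C(n,k)) < 2 T 2^C`, so `b M < 2 T < c M T`, so `b < c T`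
  have h1 : (b : ℝ) * (2 : ℝ) ^ k.choose 2 * M < 2 * T * (2 : ℝ) ^ k.choose 2 := by
    calc (b : ℝ) * (2 : ℝ) ^ k.choose 2 * M ≤ 2 * (n.choose k : ℝ) * T * M := by
          exact mul_le_mul_of_nonneg_right hA'' hMpos.le
      _ = 2 * T * ((M : ℝ) * (n.choose k : ℝ)) := by ring
      _ < 2 * T * (2 : ℝ) ^ k.choose 2 := by
          exact mul_lt_mul_of_pos_left hB'' (by positivity)
  have h2 : (b : ℝ) * M < 2 * T := by
    have h1' : ((b : ℝ) * M) * (2 : ℝ) ^ k.choose 2 < (2 * T) * (2 : ℝ) ^ k.choose 2 := by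
      calc ((b : ℝ) * M) * (2 : ℝ) ^ k.choose 2 = (b : ℝ) * (2 : ℝ) ^ k.choose 2 * M := by ring
        _ < 2 * T * (2 : ℝ) ^ k.choose 2 := h1
    exact lt_of_mul_lt_mul_right h1' hPpos.le
  have h3 : (b : ℝ) < c * T := by
    have h' : (b : ℝ) * M < (c * T) * M := by
      calc (b : ℝ) * M < 2 * T := h2
        _ < (c * M) * T := by exact mul_lt_mul_of_pos_right hcM hTpos
        _ = (c * T) * M := by ring
    exact lt_of_mul_lt_mul_right h' hMpos.le
  -- conclude: good = T - b > (1 - c) T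
  have hgood : ((univ.filter fun G : SimpleGraph (Fin n) =>
          (⟨n, G⟩ : Σ m, SimpleGraph (Fin m)) ∈
            {p : Σ m, SimpleGraph (Fin m) | p.2.CliqueFree (Nat.clog 2 (p.1 ^ 2)) ∧
              p.2ᶜ.CliqueFree (Nat.clog 2 (p.1 ^ 2))}).card : ℝ) = T - b := by
    have h := congrArg (fun x : ℕ => (x : ℝ)) hsplit
    push_cast at h
    linarith
  rw [hgood]
  linarith

/-! ### The kernel-checked composition -/

/-- **Composition.** Stubs A, B (⇒ RamseyDense) and D (TCC) imply the crux BY NAME: RAMSEY₂ is an `NP`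
language (if X fails) of `⌈2log₂n⌉`-clique-free codes, so by TCC it misses a `c`-fraction of all graphs for
infinitely many `n`, while by RamseyDense it eventually contains more than a `(1 - c)`-fraction. No `sorry`. -/
theorem RamseyNotNP_of (hA : Registered.stub_cliqueCount) (hB : Registered.stub_unionArith)
    (hD : Registered.stub_typicalCliqueCapture) : RamseyNotNP := by
  intro hNP
  obtain ⟨c, hc, hio⟩ := hD _ hNP (fun p hp => hp.1)
  obtain ⟨n₀, hn₀⟩ := ramseyDense_of hA hB c hc
  obtain ⟨n, hn, hle⟩ := hio n₀
  -- (the two `Finset.filter`s carry different `DecidablePred` instances; `convert` identifies them)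
  have hle' : ((univ.filter fun G : SimpleGraph (Fin n) =>
        (⟨n, G⟩ : Σ m, SimpleGraph (Fin m)) ∈
          {p : Σ m, SimpleGraph (Fin m) | p.2.CliqueFree (Nat.clog 2 (p.1 ^ 2)) ∧
            p.2ᶜ.CliqueFree (Nat.clog 2 (p.1 ^ 2))}).card : ℝ) ≤
      (1 - c) * Fintype.card (SimpleGraph (Fin n)) := by
    convert hle using 4
  exact absurd (hn₀ n hn) (not_lt.mpr hle')

/-- **`RamseyNotNP_closed`** — the composition as a CLOSED term (the crux modulo the `stub_*` sorries of A, B,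
D). When A and B land this is `TCC → RamseyNotNP` unconditionally in A, B. -/
theorem RamseyNotNP_closed : RamseyNotNP :=
  RamseyNotNP_of stub_cliqueCount stub_unionArith stub_typicalCliqueCapture

/-! ### Alternative entry: the nondeterministic planted-clique refutation hypothesis -/

/-- **nPCR(ε) ⇒ TCC** given Stub C: certificates of `ω < ⌈2log₂n⌉` are certificates of `ω ≤ ⌈n^{1/2-ε}⌉`
for large `n`. Here nPCR(ε) (inline): every `NP` language of graph codes whose large members are all
`⌈n^{1/2-ε}⌉₊`-clique-free misses a constant fraction of all graphs infinitely often. -/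
theorem typicalCliqueCapture_of_planted (hC : Registered.stub_thresholdBelowPoly) {ε : ℝ} (hε : 0 < ε)
    (hε' : ε < 1 / 2)
    (hP : ∀ S : Set (Σ n, SimpleGraph (Fin n)),
      encodingGraph.toLanguage S ∈ Nondeterministic.NP →
      (∃ N : ℕ, ∀ p ∈ S, N ≤ p.1 → p.2.CliqueFree ⌈(p.1 : ℝ) ^ (1 / 2 - ε)⌉₊) →
      ∃ c : ℝ, 0 < c ∧ ∀ n₀ : ℕ, ∃ n ≥ n₀,
        ((univ.filter fun G : SimpleGraph (Fin n) => (⟨n, G⟩ : Σ m, SimpleGraph (Fin m)) ∈ S).card : ℝ) ≤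
          (1 - c) * Fintype.card (SimpleGraph (Fin n))) :
    Registered.stub_typicalCliqueCapture := by
  intro S hS hsub
  obtain ⟨N, hN⟩ := hC ε hε hε'
  refine hP S hS ⟨N, fun p hp hNp => ?_⟩
  exact (hsub hp).mono (hN p.1 hNp)

/- Alternative composition (documentation only — a second theorem concluding the crux would confuse the
skeleton checker): for any fixed `0 < ε < 1/2`,
`RamseyNotNP_of hA hB (typicalCliqueCapture_of_planted hC hε hε' hP) : RamseyNotNP`
is `A → B → C → nPCR(ε) → RamseyNotNP`. -/

end

end Summit.PneNP.PneNP.Cruxes.RamseyNotNP.TypicalCapture
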